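import Literature.MathematicalPhysics.QuantumFieldTheory.Balaban1983to89.B12ComplexifiedGroup
import Literature.MathematicalPhysics.QuantumFieldTheory.Balaban1983to89.B12IdentityComponentClosedSubgroup
import Literature.MathematicalPhysics.QuantumFieldTheory.Balaban1983to89.LogChartBCHClosure
import Literature.MathematicalPhysics.QuantumFieldTheory.Balaban1983to89.B12RegularSpaces111SpecialUnitary
import Literature.MathematicalPhysics.QuantumFieldTheory.Balaban1983to89.B12RegularSpaces111Unitary

/-!
# `Balaban1983to89.B12RegularSpaces111ClosedSubgroup` — T. Bałaban, *Renormalization group approach to lattice gauge field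
theories. I*, Commun. Math. Phys. **109** (1987) 249–301 [Balaban1987RG1], pp. 251–252: the VALUE DATA `⟨G, Gᶜ, 𝔤ᶜ⟩` of the
concrete regular spaces (1.10)–(1.16) (`B12RegularSpaces111.Model`) AT PRINT'S GENERALITY «an arbitrary semisimple compact Lie
group G ⊂ U(N)» — INSTANTIATED FOR EVERY CLOSED SUBGROUP `G ≤ U(N)` from the Chevalley complexification `Gᶜ`
(`B12ComplexifiedGroup.complexifiedGroup`) and the complexified Lie algebra `𝐠ᶜ` (`B12LieComplexification.lieC`), with the standing
model hypotheses of the concrete-spaces lineage DISCHARGED; on the way: the Lie algebra of EVERY log-charted group is closed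
under the Baker–Campbell–Hausdorff composition on the WHOLE convergence range `‖X‖ + ‖Y‖ < log 2` (analytic continuation from the
chart radius), and `Gᶜ` is log-charted whenever it is closed in `M_N(ℂ)` — in particular for every closed `G ≤ SU(N)`

HONEST FRAMING (cell `lit-balaban`, verbatim): statement-level skeleton of published theorems with citation tags; proofs where
landed; nothing here is a claim about the Yang–Mills mass gap.

CITATION HEADER (lean-in-tree rule).  Cell `lit-balaban`, unit `lit-balaban-r20` (reader/typer r20 gen 16: B12 fold owner and
DEFINITIONS steward — pair register «model instances»; TAKING line HOME/STATUS.md 2026-08-22T05:3xZ; file 2 of 2, file 1 =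
`LogChartBCHClosure`), HOME
`run/shared/lean/pub/lit-balaban/`.  Source held: `paper:balaban1987-cmp109-rg-i-small-field` (journal page = PDF page + 248);
pp. 251–252 [PDF 3–4], 259 [PDF 11], 262 [PDF 14], 276 [PDF 28] read from the text layer and the renders
`b2b-balaban-ref1/pages/1987-cmp109-rg-I-small-field/…-p003/p004/p011/p014-x2.png`.

THE PRINT, verbatim.  pp. 251–252: *«Field configurations have values in a compact Lie group G. … We assume that G is
semisimple and that it is a Lie subgroup of a group of complex unitary matrices, for example G ⊂ U(N). (In fact a bigger part of
our considerations does not depend on the semisimplicity assumption.)»*; p. 252: *«For technical reasons we wish to establish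
analyticity with respect to group valued gauge fields. Therefore we also consider the complexified group Gᶜ. Elements of this
group are defined as matrices of the form 𝐔 = U′U, where U ∈ G and U′ = exp iA′, A′ ∈ 𝐠ᶜ, 𝐠ᶜ is the complexification of the
real Lie algebra 𝐠.»*; p. 259: *«It will be proved in this paper for an arbitrary semisimple compact Lie group G ⊂ U(N), and for
d = 4.»*; p. 262: *«The gauge field configuration 𝐔 is defined at bonds of X and has values in Gᶜ, the configuration 𝐉 is also
defined at bonds of X and has values in 𝐠ᶜ. A Gᶜ-valued gauge transformation u acts on pairs (𝐔, 𝐉) … (1.10) … (i) 𝐔 = U′U, U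
has values in the group G, … (ii) U′ = exp iξA′, A′ has values in the algebra 𝐠ᶜ, |A′|, |∇^ξ_U A′| < α₁ on X. (1.13)»*; p. 276:
*«The functions (3.25), (3.26) are gauge invariant with respect to the simultaneous gauge transformations 𝐔 → 𝐔^u, 𝐉 → R(u)𝐉,
B → R(u)B, (3.29) for Gᶜ-valued transformations u in a sufficiently small neighborhood of G-valued transformations, so that the
configurations after the transformations belong to proper spaces also.»*

WHY THIS FILE (steward's pair register; nothing of the paper is asserted beyond the sentences above).  The concrete-spaces
lineage (p07: `B12RegularSpaces111(Gauge|Mono)`, `B12Spaces329Near(Sharp|Step)`, `B13Space134`) carries print's value groups as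
the ABSTRACT record `Model 𝔸 = ⟨G, Gᶜ, 𝔤ᶜ⟩` and proves every invariance theorem under six elementary MODEL HYPOTHESES
(`hG1 : ‖g‖ ≤ 1 on G`, `hGc : G ≤ Gᶜ`, `hgc : Ad(G)𝔤ᶜ ⊆ 𝔤ᶜ`, `hgcN : 𝔤ᶜ closed under the BCH composition newPot ξ`,
`heGc : exp iξE ∈ Gᶜ`, `hgcE : Ad(exp iξE)𝔤ᶜ ⊆ 𝔤ᶜ`), discharged so far only for the two HAND-MADE instances `unitaryModel`
(`G = U(N)`, p07 gen 5) and `suModel` (`G = SU(N)`, p07 gen 5).  p24 (gens 8–11) has since put print's §0 group theory in the tree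
FOR EVERY CLOSED `G ≤ U(N)`: `𝐠 = lieSubalgebra G`, `𝐠ᶜ = lieC G` (`B12LieComplexification`), and the group `Gᶜ =
complexifiedGroup G ≤ GL(N, ℂ)` with the p. 252 sentence `mem_complexifiedGroup_iff_exists_lieC` and `Lie(Gᶜ) = 𝐠ᶜ`
(`B12ComplexifiedGroup`).  This file KNITS the two: ONE model constructor `closedSubgroupModel G` for every closed `G ≤ U(N)`, the
six hypotheses as theorems, and the two hand-made instances recovered as its values at `G = SU(N)` and `G = U(N)`.

WHAT IS PROVED (kernel-checked; `M_N(ℂ)` with the operator norm (0.19) of [Balaban1985Averaging] — scope `Matrix.Norms.L2Operator`,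
as in the whole lineage).
§1 (file 1 of the pair, `LogChartBCHClosure`, used by name) **BCH CLOSURE AT THE FULL RADIUS for EVERY log-charted group**:
   `X, Y ∈ 𝔤, ‖X‖ + ‖Y‖ < log 2 ⟹ log(e^X e^Y) ∈ 𝔤` (`bchLog_mem_lie_of_lt`, analytic continuation from the chart radius), hence
   `newPot ξ A A′ ∈ 𝔤ᶜ` for a complex closed `𝔤ᶜ` on the lineage's range `ξ(‖A‖ + ‖A′‖) ≤ 1/4` (`newPot_mem_lie_of_le_quarter`).
§2 **`Gᶜ` IS LOG-CHARTED whenever it is closed in `M_N(ℂ)`** (`complexifiedLogChart`: the tree's von Neumann–Cartan chart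
   `LogChartClosedSubgroup.unitsSubgroupLogChart` of p24's `complexifiedGroup G`), with Lie algebra EXACTLY `𝐠ᶜ = lieC G`
   (`mem_complexifiedLogChart_lie_iff`, from p24's `Lie(Gᶜ) = 𝐠ᶜ`); the closedness holds for every closed `G ≤ SU(N)` — print's
   connected semisimple compact groups — since `Gᶜ ≤ SU(N)ᶜ = SL(N, ℂ)` (`algHull_mono`, p24's `…_eq_ker_det`) and a subset of
   `SL(N, ℂ)` closed in `GL(N, ℂ)` is closed in `M_N(ℂ)` (`isClosed_val_image_complexifiedGroup_of_le`).  `Ad(Gᶜ)`-stability of `𝐠ᶜ`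
   (`conj_mem_lieC`) needs no closedness: `e^{t·g Z g⁻¹} = g e^{tZ} g⁻¹` on one-parameter subgroups of the hull.
§3 **THE MODEL `closedSubgroupModel G = ⟨G, Gᶜ, 𝐠ᶜ⟩` FOR EVERY CLOSED `G ≤ U(N)`** and its six hypotheses: `hG1` (C⋆-identity),
   `hGc` (p24 `map_le_complexifiedGroup`), `hgc`/`hgcE` (§2 `conj_mem_lieC`), `heGc` (p24 `expUnit_mem_complexifiedGroup_of_mem_lieC`),
   and `hgcN` at the lineage's radius `ξ(‖X‖ + ‖Y‖) ≤ 1/4` under the closedness of `Gᶜ` in `M_N(ℂ)` (§1 + §2) — in particular for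
   every closed `G ≤ SU(N)`.
§4 **HYPOTHESIS-FREE COROLLARIES at print's generality**: (i)–(iii), (3.16) and [II] (1.34) are invariant under `G`-valued gauge
   transformations for EVERY closed `G ≤ U(N)`; the near-`G` clause of (3.29) (`satisfiesI_III_act_near_step`,
   `exists_neighbourhood_step`) for every closed `G ≤ U(N)` with `Gᶜ` closed in `M_N(ℂ)`, so for every closed `G ≤ SU(N)`.
§5 **AGREEMENT with the hand-made instances**: `closedSubgroupModel SU(N) = suModel N` and `closedSubgroupModel U(N) = unitaryModel
   M_N(ℂ)` (field by field: p24's `SU(N)ᶜ = SL(N, ℂ)`, `𝔰𝔲(N)ᶜ = 𝔰𝔩(N, ℂ)`, `U(N)ᶜ = GL(N, ℂ)`, and `𝔲(N)ᶜ = M_N(ℂ)`).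
§6 **PRINT'S STANDING CASE, connected**: a connected closed `G ≤ U(N)` with semisimple `𝐠` is traceless at the Lie-algebra level
   and lies in `SU(N)` (`trace_eq_zero_of_isSemisimple`, `le_specialUnitarySubgroup_of_isSemisimple`), so its `Gᶜ` is closed in `M_N(ℂ)`
   and the near-`G` clause holds for it hypothesis-free (`exists_neighbourhood_of_isSemisimple`).
§7 **PRINT'S STANDING CASE in full** («G is semisimple … G ⊂ U(N)», connected or not): the identity component `G₀` is an open normal
   subgroup of the compact `G` (p24), of finite index `k`, and `G₀ ≤ SU(N)` by §6, so `detᵏ = 1` on `G`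
   (`exists_det_pow_eq_one_of_isSemisimple`), hence on the algebraic hull `Gᶜ` (`det_pow_eq_one_of_mem_complexifiedGroup`), hence
   `Gᶜ ⊆ {detᵏ = 1}` is closed in `M_N(ℂ)` (`isClosed_val_image_complexifiedGroup_of_isSemisimple'`) and ALL SIX model hypotheses plus the
   near-`G` clause hold for EVERY closed `G ≤ U(N)` with semisimple `𝐠` (`exists_neighbourhood_of_isSemisimple'`).

HONEST SCOPE / READING NOTES.  (a) For `G` with `Gᶜ` NOT closed in `M_N(ℂ)` (e.g. `G = U(N)`, `Gᶜ = GL(N, ℂ)`; any `G` containing a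
circle of scalars) §3's `hgcN` is not claimed from §2 — for `U(N)` it is vacuous anyway (`unitaryModel_gc_newPot`); the natural
sufficient conditions PROVED here cover print's standing hypothesis completely: `G ≤ SU(N)` (§2), in particular a CONNECTED closed
`G ≤ U(N)` with semisimple `𝐠` (§6: `𝐠 = [𝐠, 𝐠]` is traceless, `le_specialUnitarySubgroup_of_isSemisimple`), and ANY closed `G ≤ U(N)` with
semisimple `𝐠` (§7: `detᵏ = 1` on `G` with `k` = number of components, e.g. `O(N) ⊂ U(N)`, `k = 2`).  Print's «semisimple» is read as
«the Lie algebra 𝐠 is semisimple» (`LieAlgebra.IsSemisimple ℝ (lieSubalgebra G)`), as in p24's `B12SemisimpleFiniteCentre`.  (b) `|·|` is the operator norm (scope `Matrix.Norms.L2Operator`), `log` the series `MatrixLog.mlog`, `exp iξA`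
the unit `B12RegularSpaces111.expI` = p24's `expUnit (iξ•A)` (`expI_eq_expUnit`, by `rfl` on values).  (c) No statement of [I] is
asserted; rows served (cells only, NO head change): B12.Def§0 (owner r20), B12.Eq1.11-1.14 / B12.Eq3.15-3.16 / B12.Eq3.28-3.29 (display
owner r09, carrier p07), B13.Lem2 (r10).  No `Prop` placeholder, no new fact; three definitions with bodies (`complexifiedLogChart`, `complexifiedLogChartSU`, `closedSubgroupModel`); axioms standard.
-/

noncomputable section

namespace Literature.MathematicalPhysics.QuantumFieldTheory.Balaban1983to89.B12RegularSpaces111ClosedSubgroup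

open NormedSpace Set
open Literature.MathematicalPhysics.QuantumFieldTheory.Balaban1983to89
open Literature.MathematicalPhysics.QuantumFieldTheory.Balaban1983to89.B12Membership313II (newPot)
open Literature.MathematicalPhysics.QuantumFieldTheory.Balaban1983to89.LogChartBCHClosure (bchLog_mem_lie_of_lt newPot_mem_lie_of_lt
  newPot_mem_lie_of_le_quarter)
open Complex (I)
open Literature.Algebra.Lie.CompactGroupAlgebraic (UN)  -- `UN n = ↥(Matrix.unitaryGroup n ℂ)` (p24's abbreviation)

/-! ## §1. (moved) BCH closure at the full radius — see `LogChartBCHClosure` (file 1 of this pair) -/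

/-! ## §2. `Gᶜ` is log-charted when closed in `M_N(ℂ)`; `Ad(Gᶜ)`-stability of `𝐠ᶜ`; closedness for `G ≤ SU(N)` -/

section Complexified

open scoped Matrix.Norms.L2Operator
open Literature.Algebra.Lie.MatrixAlgebraicHull (algHull mem_algHull_iff expUnit val_expUnit lieHull mem_lieHull_iff)
open Literature.MathematicalPhysics.QuantumFieldTheory.Balaban1983to89.B12LieComplexification (lieSubalgebra lieC)
open Literature.MathematicalPhysics.QuantumFieldTheory.Balaban1983to89.B12ComplexifiedGroup (complexifiedGroup complexifiedGroup_eq_algHull mem_lieHull_iff_mem_lieC map_le_complexifiedGroup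
  isClosed_complexifiedGroup expUnit_mem_complexifiedGroup_of_mem_lieC complexifiedGroup_specialUnitarySubgroup_eq_ker_det
  complexifiedGroup_top toUnits_mem_complexifiedGroup)
open Literature.MathematicalPhysics.QuantumFieldTheory.Balaban1983to89.B12SpecialUnitaryClosedSubgroup (specialUnitarySubgroup mem_specialUnitarySubgroup_iff isClosed_specialUnitarySubgroup)
open Literature.MathematicalPhysics.QuantumFieldTheory.Balaban1983to89.LogChartClosedSubgroup (unitsSubgroupLogChart mem_unitsSubgroupLogChart_lie_iff unitsSubgroupLogChart_carrier)

variable {n : Type*} [Fintype n] [DecidableEq n]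

-- the Lie-ring structure `⁅X, Y⁆ = XY − YX` on `M_N(ℂ)` used by `B12LieComplexification.lieC` (same idiom as p24's files)
attribute [local instance 100] LieRing.ofAssociativeRing

/-- The algebraic hull is monotone in the generating subgroup (a polynomial vanishing on the bigger group vanishes on the
smaller). [cite: BrockerTomDieck1985, III (8.2) p.152] -/
theorem algHull_mono {S T : Subgroup (Matrix n n ℂ)ˣ} (h : S ≤ T) : algHull S ≤ algHull T := fun _ hg =>
  mem_algHull_iff.2 fun P hP hPT => (mem_algHull_iff.1 hg) P hP fun s hs => hPT s (h hs)

variable (G : Subgroup (UN n)) (hG : IsClosed (G : Set (UN n)))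

/-- `Gᶜ` is monotone in `G`. [cite: Balaban1987RG1, §0 p.252] -/
theorem complexifiedGroup_mono {G H : Subgroup (UN n)} (h : G ≤ H) : complexifiedGroup G ≤ complexifiedGroup H := by
  rw [complexifiedGroup_eq_algHull, complexifiedGroup_eq_algHull]
  exact algHull_mono (Subgroup.map_mono h)

/-- `exp(t Z)` as a unit equals the tree's `expUnit (t • Z)`: membership of the matrix `e^{tZ}` in the image of a subgroup of
units is membership of the unit. [cite: Hall2015, Prop. 2.3] -/
theorem exp_mem_image_iff_expUnit_mem (S : Subgroup (Matrix n n ℂ)ˣ) (Z : Matrix n n ℂ) :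
    exp Z ∈ Units.val '' (S : Set (Matrix n n ℂ)ˣ) ↔ expUnit Z ∈ S := by
  constructor
  · rintro ⟨u, hu, hval⟩
    have : u = expUnit Z := Units.ext (by rw [hval, val_expUnit])
    exact this ▸ hu
  · intro h
    exact ⟨expUnit Z, h, val_expUnit Z⟩

/-- **`Ad(Gᶜ)`-STABILITY OF `𝐠ᶜ`** for every closed `G ≤ U(N)`: `g ∈ Gᶜ, Z ∈ 𝐠ᶜ ⟹ g Z g⁻¹ ∈ 𝐠ᶜ` — on one-parameter subgroups
`e^{t·gZg⁻¹} = g e^{tZ} g⁻¹ ∈ Gᶜ` (p24's `Lie(Gᶜ) = 𝐠ᶜ`); no closedness of `Gᶜ` in `M_N(ℂ)` needed.  This is the lineage's `hgc`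
(for `g ∈ G ≤ Gᶜ`) and `hgcE` (for `g = exp iξE ∈ Gᶜ`) at once. [cite: Balaban1987RG1, (1.10) p.262; Hall2015, Thm. 3.20] -/
theorem conj_mem_lieC {g : (Matrix n n ℂ)ˣ} (hg : g ∈ complexifiedGroup G) {Z : Matrix n n ℂ} (hZ : Z ∈ lieC G hG) :
    (g : Matrix n n ℂ) * Z * ((g⁻¹ : (Matrix n n ℂ)ˣ) : Matrix n n ℂ) ∈ lieC G hG := by
  rw [← mem_lieHull_iff_mem_lieC G hG, mem_lieHull_iff] at hZ ⊢
  intro t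
  have hconj : expUnit (t • ((g : Matrix n n ℂ) * Z * ((g⁻¹ : (Matrix n n ℂ)ˣ) : Matrix n n ℂ))) =
      g * expUnit (t • Z) * g⁻¹ := by
    refine Units.ext ?_
    rw [val_expUnit, Units.val_mul, Units.val_mul, val_expUnit]
    rw [show t • ((g : Matrix n n ℂ) * Z * ((g⁻¹ : (Matrix n n ℂ)ˣ) : Matrix n n ℂ)) =
        (g : Matrix n n ℂ) * (t • Z) * ((g⁻¹ : (Matrix n n ℂ)ˣ) : Matrix n n ℂ) by
      rw [Matrix.mul_smul, Matrix.smul_mul]]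
    exact Matrix.exp_units_conj g (t • Z)
  rw [hconj, ← complexifiedGroup_eq_algHull]
  have hg' : g ∈ algHull (G.map (Unitary.toUnits : (UN n) →* (Matrix n n ℂ)ˣ)) := by
    rw [← complexifiedGroup_eq_algHull]; exact hg
  rw [complexifiedGroup_eq_algHull]
  exact (algHull _).mul_mem ((algHull _).mul_mem hg' (hZ t)) ((algHull _).inv_mem hg')

/-- **`Gᶜ` IS LOG-CHARTED whenever it is closed in `M_N(ℂ)`**: the von Neumann–Cartan chart of the tree
(`LogChartClosedSubgroup.unitsSubgroupLogChart`: carrier `Gᶜ ⊂ M_N(ℂ)`, Lie algebra `{X | e^{tX} ∈ Gᶜ ∀ t}`, radius `ρ > 0` with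
`log(Gᶜ ∩ B̄_ρ(1)) ⊆` Lie algebra) on p24's `complexifiedGroup G`. [cite: Hall2015, Thm. 3.42, Cor. 3.44; Balaban1987RG1, §0 p.252] -/
def complexifiedLogChart (hc : IsClosed (Units.val '' (complexifiedGroup G : Set (Matrix n n ℂ)ˣ))) :
    LogChart (Matrix n n ℂ) :=
  unitsSubgroupLogChart (complexifiedGroup G) hc

/-- Its carrier is `Gᶜ` (as a set of matrices). [cite: Balaban1987RG1, §0 p.252] -/
theorem complexifiedLogChart_carrier (hc : IsClosed (Units.val '' (complexifiedGroup G : Set (Matrix n n ℂ)ˣ))) :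
    (complexifiedLogChart G hc).carrier = Units.val '' (complexifiedGroup G : Set (Matrix n n ℂ)ˣ) := rfl

/-- **Its Lie algebra is EXACTLY `𝐠ᶜ`** (p24's `Lie(Gᶜ) = 𝐠ᶜ`, `mem_lieHull_iff_mem_lieC`). [cite: Balaban1987RG1, §0 p.252; BrockerTomDieck1985, III (8.3) p.153] -/
theorem mem_complexifiedLogChart_lie_iff (hc : IsClosed (Units.val '' (complexifiedGroup G : Set (Matrix n n ℂ)ˣ)))
    {X : Matrix n n ℂ} : X ∈ (complexifiedLogChart G hc).lie ↔ X ∈ lieC G hG := by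
  rw [complexifiedLogChart, mem_unitsSubgroupLogChart_lie_iff, ← mem_lieHull_iff_mem_lieC G hG, mem_lieHull_iff,
    ← complexifiedGroup_eq_algHull]
  exact forall_congr' fun t => exp_mem_image_iff_expUnit_mem _ _

/-- The Lie algebra of the chart as a set is `𝐠ᶜ`. [cite: Balaban1987RG1, §0 p.252] -/
theorem complexifiedLogChart_lie_eq (hc : IsClosed (Units.val '' (complexifiedGroup G : Set (Matrix n n ℂ)ˣ))) :
    (complexifiedLogChart G hc).lie = (lieC G hG).toSubmodule.restrictScalars ℝ := by
  ext X
  rw [mem_complexifiedLogChart_lie_iff G hG hc, Submodule.restrictScalars_mem, LieSubalgebra.mem_toSubmodule]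

/-- `𝐠ᶜ` is closed in `M_N(ℂ)` (finite dimension). [cite: Balaban1987RG1, §0 p.252] -/
theorem isClosed_lieC : IsClosed ((lieC G hG : Set (Matrix n n ℂ))) := by
  haveI : FiniteDimensional ℝ (Matrix n n ℂ) := FiniteDimensional.complexToReal _
  exact ((lieC G hG).toSubmodule.restrictScalars ℝ).closed_of_finiteDimensional

/-- **BCH CLOSURE OF `𝐠ᶜ` at the lineage's radius**, for every closed `G ≤ U(N)` whose `Gᶜ` is closed in `M_N(ℂ)`:
`A, A′ ∈ 𝐠ᶜ`, `0 ≤ ξ`, `ξ(|A| + |A′|) ≤ 1/4 ⟹ newPot ξ A A′ ∈ 𝐠ᶜ` (§1 on the chart of `Gᶜ`). [cite: Balaban1987RG1, (1.13) p.262] -/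
theorem newPot_mem_lieC (hc : IsClosed (Units.val '' (complexifiedGroup G : Set (Matrix n n ℂ)ˣ))) {ξ : ℝ} (hξ : 0 ≤ ξ)
    {A A' : Matrix n n ℂ} (hA : A ∈ lieC G hG) (hA' : A' ∈ lieC G hG) (h : ξ * (‖A‖ + ‖A'‖) ≤ 1 / 4) :
    newPot ξ A A' ∈ lieC G hG := by
  have hK : IsClosed ((complexifiedLogChart G hc).lie : Set (Matrix n n ℂ)) := by
    rw [complexifiedLogChart_lie_eq G hG hc]; exact isClosed_lieC G hG
  have hI : ∀ ⦃X : Matrix n n ℂ⦄, X ∈ (complexifiedLogChart G hc).lie → (I : ℂ) • X ∈ (complexifiedLogChart G hc).lie :=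
    fun X hX => (mem_complexifiedLogChart_lie_iff G hG hc).2 ((lieC G hG).smul_mem I ((mem_complexifiedLogChart_lie_iff G hG hc).1 hX))
  exact (mem_complexifiedLogChart_lie_iff G hG hc).1 (newPot_mem_lie_of_le_quarter _ hK hI hξ
    ((mem_complexifiedLogChart_lie_iff G hG hc).2 hA) ((mem_complexifiedLogChart_lie_iff G hG hc).2 hA') h)

/-- **`Gᶜ ≤ SL(N, ℂ)` for `G ≤ SU(N)`** (`Gᶜ ≤ SU(N)ᶜ = SL(N, ℂ)`, p24). [cite: Balaban1987RG1, §0 p.252] -/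
theorem det_eq_one_of_mem_complexifiedGroup_of_le [Nonempty n] (hSU : G ≤ specialUnitarySubgroup n) {g : (Matrix n n ℂ)ˣ}
    (hg : g ∈ complexifiedGroup G) : (g : Matrix n n ℂ).det = 1 := by
  have := complexifiedGroup_mono hSU hg
  rw [complexifiedGroup_specialUnitarySubgroup_eq_ker_det, MonoidHom.mem_ker, Units.ext_iff,
    Matrix.GeneralLinearGroup.val_det_apply, Units.val_one] at this
  exact this

/-- **`Gᶜ` IS CLOSED IN `M_N(ℂ)` for every closed `G ≤ SU(N)`**: `Gᶜ` is closed in `GL(N, ℂ)` (p24), `GL(N, ℂ) → M_N(ℂ)` is an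
(open) embedding, and `Gᶜ ⊆ SL(N, ℂ)` which is closed in `M_N(ℂ)`. [cite: BrockerTomDieck1985, III (8.2) p.152; Balaban1987RG1, §0 p.252] -/
theorem isClosed_val_image_complexifiedGroup_of_le [Nonempty n] (hSU : G ≤ specialUnitarySubgroup n) :
    IsClosed (Units.val '' (complexifiedGroup G : Set (Matrix n n ℂ)ˣ)) := by
  obtain ⟨T, hT, hpre⟩ := (Units.isOpenEmbedding_val (R := Matrix n n ℂ)).isInducing.isClosed_iff.1
    (isClosed_complexifiedGroup G)
  have hD : IsClosed {A : Matrix n n ℂ | A.det = 1} := isClosed_singleton.preimage continuous_id.matrix_det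
  suffices h : Units.val '' (complexifiedGroup G : Set (Matrix n n ℂ)ˣ) = T ∩ {A : Matrix n n ℂ | A.det = 1} by
    rw [h]; exact hT.inter hD
  ext A
  constructor
  · rintro ⟨g, hg, rfl⟩
    refine ⟨?_, det_eq_one_of_mem_complexifiedGroup_of_le G hSU hg⟩
    have : g ∈ Units.val ⁻¹' T := by rw [hpre]; exact hg
    exact this
  · rintro ⟨hAT, hAdet⟩
    have hAu : IsUnit A := by
      rw [Matrix.isUnit_iff_isUnit_det, hAdet]; exact isUnit_one
    refine ⟨hAu.unit, ?_, hAu.unit_spec⟩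
    have : hAu.unit ∈ Units.val ⁻¹' T := by
      show (hAu.unit : Matrix n n ℂ) ∈ T
      rw [hAu.unit_spec]; exact hAT
    rw [hpre] at this
    exact this

/-- Hence: **`Gᶜ` is log-charted for every closed `G ≤ SU(N)`** (print's connected semisimple compact `G ⊂ U(N)`).
[cite: Balaban1987RG1, §0 pp.251–252; Hall2015, Thm. 3.42] -/
def complexifiedLogChartSU [Nonempty n] (hSU : G ≤ specialUnitarySubgroup n) : LogChart (Matrix n n ℂ) :=
  complexifiedLogChart G (isClosed_val_image_complexifiedGroup_of_le G hSU)

end Complexified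

/-! ## §3. The value data `⟨G, Gᶜ, 𝐠ᶜ⟩` for every closed `G ≤ U(N)`, and the six model hypotheses -/

section TheModel

open scoped Matrix.Norms.L2Operator
open Literature.Algebra.Lie.MatrixAlgebraicHull (expUnit val_expUnit)
open Literature.MathematicalPhysics.QuantumFieldTheory.Balaban1983to89.B12LieComplexification (lieSubalgebra lieC)
open Literature.MathematicalPhysics.QuantumFieldTheory.Balaban1983to89.B12ComplexifiedGroup (complexifiedGroup
  map_le_complexifiedGroup expUnit_mem_complexifiedGroup_of_mem_lieC toUnits_mem_complexifiedGroup)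
open Literature.MathematicalPhysics.QuantumFieldTheory.Balaban1983to89.B12SpecialUnitaryClosedSubgroup (specialUnitarySubgroup)
open Literature.MathematicalPhysics.QuantumFieldTheory.Balaban1983to89.B12RegularSpaces111 (Model expI)

variable {n : Type*} [Fintype n] [DecidableEq n]

attribute [local instance 100] LieRing.ofAssociativeRing

variable (G : Subgroup (UN n)) (hG : IsClosed (G : Set (UN n)))

/-- **THE VALUE DATA OF (1.10) FOR EVERY CLOSED `G ≤ U(N)`** (print: «G … a Lie subgroup of a group of complex unitary matrices, for
example G ⊂ U(N)», «the complexified group Gᶜ», «𝐠ᶜ is the complexification of the real Lie algebra 𝐠»): `G` (inside `GL(N, ℂ)`),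
`Gᶜ = complexifiedGroup G` (p24), `𝐠ᶜ = lieC G` (p24) packaged as p07's `B12RegularSpaces111.Model M_N(ℂ)`.
[cite: Balaban1987RG1, §0 pp.251–252, (1.10) p.262] -/
def closedSubgroupModel : Model (Matrix n n ℂ) where
  G := G.map (Unitary.toUnits : (UN n) →* (Matrix n n ℂ)ˣ)
  Gc := complexifiedGroup G
  gc := (lieC G hG).toSubmodule

/-- `G` of the model: the image of `G` in `GL(N, ℂ)`. [cite: Balaban1987RG1, §0 p.252] -/
theorem closedSubgroupModel_G : (closedSubgroupModel G hG).G = G.map (Unitary.toUnits : (UN n) →* (Matrix n n ℂ)ˣ) := rfl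

/-- `Gᶜ` of the model is p24's `complexifiedGroup G`. [cite: Balaban1987RG1, §0 p.252] -/
theorem closedSubgroupModel_Gc : (closedSubgroupModel G hG).Gc = complexifiedGroup G := rfl

/-- `𝐠ᶜ` of the model is p24's `lieC G`. [cite: Balaban1987RG1, §0 p.252] -/
theorem mem_closedSubgroupModel_gc_iff {X : Matrix n n ℂ} : X ∈ (closedSubgroupModel G hG).gc ↔ X ∈ lieC G hG := Iff.rfl

/-- Membership in the model's `G`: the matrix is unitary and, as an element of `U(N)`, lies in `G`. [cite: Balaban1987RG1, §0 p.252] -/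
theorem mem_closedSubgroupModel_G_iff {g : (Matrix n n ℂ)ˣ} :
    g ∈ (closedSubgroupModel G hG).G ↔ ∃ h : (g : Matrix n n ℂ) ∈ Matrix.unitaryGroup n ℂ, (⟨(g : Matrix n n ℂ), h⟩ : UN n) ∈ G := by
  rw [closedSubgroupModel_G, Subgroup.mem_map]
  constructor
  · rintro ⟨u, hu, rfl⟩
    exact ⟨u.2, by simpa using hu⟩
  · rintro ⟨h, hmem⟩
    refine ⟨⟨(g : Matrix n n ℂ), h⟩, hmem, Units.ext ?_⟩
    rfl

/-- The lineage's `exp iξA` (`B12RegularSpaces111.expI`, value `e^{iξA}`, inverse `e^{−iξA}`) IS p24's unit `expUnit (iξ•A)`.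
[cite: Balaban1987RG1, (1.13) p.262] -/
theorem expI_eq_expUnit (ξ : ℝ) (A : Matrix n n ℂ) : expI ξ A = expUnit ((I * (ξ : ℂ)) • A) := Units.ext rfl

/-- **`hG1`: `|U| ≤ 1`** (operator norm) on `G` — unitary matrices have norm `1` (C⋆-identity). [cite: Balaban1987RG1, §0 p.252] -/
theorem closedSubgroupModel_norm_le : ∀ g ∈ (closedSubgroupModel G hG).G, ‖(g : Matrix n n ℂ)‖ ≤ 1 := by
  intro g hg
  obtain ⟨h, -⟩ := (mem_closedSubgroupModel_G_iff G hG).1 hg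
  rcases subsingleton_or_nontrivial (Matrix n n ℂ) with hs | hs
  · rw [Subsingleton.elim (g : Matrix n n ℂ) 0, norm_zero]; exact zero_le_one
  · exact (CStarRing.norm_of_mem_unitary h).le

/-- **`hGc`: `G ≤ Gᶜ`** (p24's `map_le_complexifiedGroup`). [cite: Balaban1987RG1, §0 p.252] -/
theorem closedSubgroupModel_G_le_Gc : (closedSubgroupModel G hG).G ≤ (closedSubgroupModel G hG).Gc :=
  map_le_complexifiedGroup G

/-- **`hgc`: `𝐠ᶜ` is `Ad(G)`-stable** (§2 `conj_mem_lieC` with `G ≤ Gᶜ`). [cite: Balaban1987RG1, (1.10) p.262] -/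
theorem closedSubgroupModel_gc_conj : ∀ g ∈ (closedSubgroupModel G hG).G, ∀ X ∈ (closedSubgroupModel G hG).gc,
    (g : Matrix n n ℂ) * X * ((g⁻¹ : (Matrix n n ℂ)ˣ) : Matrix n n ℂ) ∈ (closedSubgroupModel G hG).gc :=
  fun _ hg _ hX => conj_mem_lieC G hG (map_le_complexifiedGroup G hg) hX

/-- **`heGc`: `exp iξE(x) ∈ Gᶜ` for `𝐠ᶜ`-valued `E`** (p24's `exp(𝐠ᶜ) ⊆ Gᶜ`; `𝐠ᶜ` is a complex subspace). [cite: Balaban1987RG1, (1.10) p.262] -/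
theorem closedSubgroupModel_expI_mem_Gc {S : Type*} (ξ : ℝ) {E : S → Matrix n n ℂ}
    (hE : ∀ x, E x ∈ (closedSubgroupModel G hG).gc) : ∀ x, expI ξ (E x) ∈ (closedSubgroupModel G hG).Gc := fun x => by
  rw [expI_eq_expUnit, closedSubgroupModel_Gc]
  exact expUnit_mem_complexifiedGroup_of_mem_lieC G hG ((lieC G hG).smul_mem _ (hE x))

/-- **`hgcE`: `𝐠ᶜ` is `Ad(exp iξE)`-stable** (§2 `conj_mem_lieC` with `exp iξE ∈ Gᶜ`). [cite: Balaban1987RG1, (1.10) p.262] -/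
theorem closedSubgroupModel_gc_conjE {S : Type*} (ξ : ℝ) {E : S → Matrix n n ℂ} (hE : ∀ x, E x ∈ (closedSubgroupModel G hG).gc) :
    ∀ x, ∀ X ∈ (closedSubgroupModel G hG).gc,
      (expI ξ (E x) : Matrix n n ℂ) * X * (((expI ξ (E x))⁻¹ : (Matrix n n ℂ)ˣ) : Matrix n n ℂ) ∈ (closedSubgroupModel G hG).gc :=
  fun x _ hX => conj_mem_lieC G hG (closedSubgroupModel_expI_mem_Gc G hG ξ hE x) hX

/-- **`hgcN` (step form): `𝐠ᶜ` is closed under `newPot ξ` in the lineage's range `ξ(|X| + |Y|) ≤ 1/4`, `ξ ≥ 0`**, for every closed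
`G ≤ U(N)` whose `Gᶜ` is closed in `M_N(ℂ)` (§1–§2). [cite: Balaban1987RG1, (1.13) p.262] -/
theorem closedSubgroupModel_gc_newPot (hc : IsClosed (Units.val '' (complexifiedGroup G : Set (Matrix n n ℂ)ˣ)))
    {ξ : ℝ} (hξ : 0 ≤ ξ) : ∀ X ∈ (closedSubgroupModel G hG).gc, ∀ Y ∈ (closedSubgroupModel G hG).gc,
      ξ * (‖X‖ + ‖Y‖) ≤ 1 / 4 → newPot ξ X Y ∈ (closedSubgroupModel G hG).gc :=
  fun _ hX _ hY h => newPot_mem_lieC G hG hc hξ hX hY h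

/-- `hgcN` for every closed `G ≤ SU(N)`. [cite: Balaban1987RG1, §0 pp.251–252, (1.13) p.262] -/
theorem closedSubgroupModel_gc_newPot_of_le [Nonempty n] (hSU : G ≤ specialUnitarySubgroup n) {ξ : ℝ} (hξ : 0 ≤ ξ) :
    ∀ X ∈ (closedSubgroupModel G hG).gc, ∀ Y ∈ (closedSubgroupModel G hG).gc,
      ξ * (‖X‖ + ‖Y‖) ≤ 1 / 4 → newPot ξ X Y ∈ (closedSubgroupModel G hG).gc :=
  closedSubgroupModel_gc_newPot G hG (isClosed_val_image_complexifiedGroup_of_le G hSU) hξ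

/-- «`E` is `𝐠ᶜ`-valued» in the model reads `E x ∈ lieC G`. [cite: Balaban1987RG1, (1.13) p.262] -/
theorem closedSubgroupModel_gcValued {S : Type*} {E : S → Matrix n n ℂ} (hE : ∀ x, E x ∈ lieC G hG) :
    ∀ x, E x ∈ (closedSubgroupModel G hG).gc := hE

end TheModel

/-! ## §4. Hypothesis-free corollaries for every closed `G ≤ U(N)` (near-`G` clause: `Gᶜ` closed in `M_N(ℂ)`, e.g. `G ≤ SU(N)`) -/

section Corollaries

open scoped Matrix.Norms.L2Operator
open Literature.MathematicalPhysics.QuantumFieldTheory.Balaban1983to89.B12LieComplexification (lieC)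
open Literature.MathematicalPhysics.QuantumFieldTheory.Balaban1983to89.B12ComplexifiedGroup (complexifiedGroup)
open Literature.MathematicalPhysics.QuantumFieldTheory.Balaban1983to89.B12SpecialUnitaryClosedSubgroup (specialUnitarySubgroup)
open Literature.MathematicalPhysics.QuantumFieldTheory.Balaban1983to89.B12RegularSpaces111
open Literature.MathematicalPhysics.QuantumFieldTheory.Balaban1983to89.B12RegularSpaces111Gauge (satisfiesI_III_act_iff
  act_mem_space316_iff)
open Literature.MathematicalPhysics.QuantumFieldTheory.Balaban1983to89.B12Spaces329NearStep (satisfiesI_III_act_near_step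
  exists_neighbourhood_step)
open Literature.MathematicalPhysics.QuantumFieldTheory.Balaban1983to89.B13Space134 (space134 act329 act329_mem_space134_iff)

variable {n : Type*} [Fintype n] [DecidableEq n]

attribute [local instance 100] LieRing.ofAssociativeRing

variable (G : Subgroup (UN n)) (hG : IsClosed (G : Set (UN n)))
variable {P : Params} {i : ℕ}

/-- **(i)–(iii) are invariant under `G`-valued gauge transformations, for EVERY closed `G ≤ U(N)`** (same constants).
[cite: Balaban1987RG1, (3.29) p.276, p.263 («The spaces U^c_j(X, α₀, α₁) are, by the definition, gauge invariant»)] -/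
theorem satisfiesI_III_act_iff_closed {F : Frame P i (Matrix n n ℂ)} {c : StepConsts} {α₀ α₁ γ₀ : ℝ}
    (Φ : FieldPair P i (Matrix n n ℂ)ˣ (Matrix n n ℂ)) {v : Site P i → (Matrix n n ℂ)ˣ} (hv : ∀ x, v x ∈ (closedSubgroupModel G hG).G) :
    SatisfiesI_III (closedSubgroupModel G hG) F c α₀ α₁ γ₀ (act v Φ) ↔ SatisfiesI_III (closedSubgroupModel G hG) F c α₀ α₁ γ₀ Φ :=
  satisfiesI_III_act_iff (closedSubgroupModel_norm_le G hG) (closedSubgroupModel_G_le_Gc G hG) (closedSubgroupModel_gc_conj G hG) Φ hv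

/-- **(3.16) is invariant under `G`-valued gauge transformations, for EVERY closed `G ≤ U(N)`.** [cite: Balaban1987RG1, (3.16) p.273] -/
theorem act_mem_space316_iff_closed {Fj : Frame P i (Matrix n n ℂ)} {cj : StepConsts} {Fk : Frame P i (Matrix n n ℂ)} {ck : StepConsts}
    {β α₀ α₁ : ℝ} (Φ : FieldPair P i (Matrix n n ℂ)ˣ (Matrix n n ℂ)) {v : Site P i → (Matrix n n ℂ)ˣ}
    (hv : ∀ x, v x ∈ (closedSubgroupModel G hG).G) :
    act v Φ ∈ space316 (closedSubgroupModel G hG) Fj cj Fk ck β α₀ α₁ ↔ Φ ∈ space316 (closedSubgroupModel G hG) Fj cj Fk ck β α₀ α₁ :=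
  act_mem_space316_iff (closedSubgroupModel_norm_le G hG) (closedSubgroupModel_G_le_Gc G hG) (closedSubgroupModel_gc_conj G hG) Φ hv

/-- **[II] (1.34) is invariant under `G`-valued gauge transformations, for EVERY closed `G ≤ U(N)`** (Lemma 2's gauge clause).
[cite: Balaban1988RG2Cluster, Lemma 2 p.11] -/
theorem act329_mem_space134_iff_closed {F : Frame P i (Matrix n n ℂ)} {c : StepConsts} {β α₀ α₁ ε₁ g : ℝ}
    (Ψ : FieldPair P i (Matrix n n ℂ)ˣ (Matrix n n ℂ) × (PBond P i → Matrix n n ℂ)) {u : Site P i → (Matrix n n ℂ)ˣ}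
    (hu : ∀ x, u x ∈ (closedSubgroupModel G hG).G) :
    act329 u Ψ ∈ space134 (closedSubgroupModel G hG) F c β α₀ α₁ ε₁ g ↔ Ψ ∈ space134 (closedSubgroupModel G hG) F c β α₀ α₁ ε₁ g :=
  act329_mem_space134_iff (closedSubgroupModel_norm_le G hG) (closedSubgroupModel_G_le_Gc G hG) Ψ hu

/-- **The near-`G` clause of (3.29), sharp constants, for every closed `G ≤ U(N)` with `Gᶜ` closed in `M_N(ℂ)`**: for `(𝐔, 𝐉)`
satisfying (i)–(iii) with `(α₀, α₁, γ₀)` on the whole lattice and `v = w·exp(iξE)` with `w` `G`-valued, `E` `𝐠ᶜ`-valued, `|E| ≤ δ₀`,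
`|∇^ξ_𝐔E| ≤ δ₁`, `ξ(α₁ + 2δ₀) ≤ 1/16`, the pair `(𝐔, 𝐉)^v` satisfies (i)–(iii) with any `α₀′ ≥ e^{2ξδ₀}α₀`, `γ₀′ ≥ e^{2ξδ₀}γ₀`,
`α₁′ ≥ α₁ + (3 + 12α₁ + 3ξα₀)δ₀ + 4δ₁` (p07's `satisfiesI_III_act_near_step` with ALL model hypotheses discharged).
[cite: Balaban1987RG1, (3.29) p.276] -/
theorem satisfiesI_III_act_near_closed (hc : IsClosed (Units.val '' (complexifiedGroup G : Set (Matrix n n ℂ)ˣ)))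
    {F : Frame P i (Matrix n n ℂ)} (hXb : ∀ b, b ∈ F.X.bonds) (hXp : ∀ p, p ∈ F.X.plaqs) {c : StepConsts} (hξ : 0 < c.ξ)
    (hcB : 0 ≤ c.cB) {α₀ α₁ γ₀ δ₀ δ₁ α₀' α₁' γ₀' : ℝ} (hα₀ : 0 ≤ α₀) (hα₁ : 0 ≤ α₁) (hδ₁ : 0 ≤ δ₁)
    (hs : c.ξ * (α₁ + 2 * δ₀) ≤ 1 / 16) (hα₀' : Real.exp (2 * (c.ξ * δ₀)) * α₀ ≤ α₀') (hγ₀' : Real.exp (2 * (c.ξ * δ₀)) * γ₀ ≤ γ₀')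
    (hα₁' : α₁ + (3 + 12 * α₁ + 3 * c.ξ * α₀) * δ₀ + 4 * δ₁ ≤ α₁')
    {Φ : FieldPair P i (Matrix n n ℂ)ˣ (Matrix n n ℂ)} (h : SatisfiesI_III (closedSubgroupModel G hG) F c α₀ α₁ γ₀ Φ)
    {w : Site P i → (Matrix n n ℂ)ˣ} (hw : ∀ x, w x ∈ (closedSubgroupModel G hG).G) {E : Site P i → Matrix n n ℂ}
    (hE : ∀ x, E x ∈ lieC G hG) (hE0 : ∀ x, ‖E x‖ ≤ δ₀) (hE1 : ∀ x μ, ‖nabla c.ξ Φ.U μ E x‖ ≤ δ₁) :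
    SatisfiesI_III (closedSubgroupModel G hG) F c α₀' α₁' γ₀' (act (w * fun x => expI c.ξ (E x)) Φ) :=
  satisfiesI_III_act_near_step (closedSubgroupModel_norm_le G hG) (closedSubgroupModel_G_le_Gc G hG) (closedSubgroupModel_gc_conj G hG)
    (closedSubgroupModel_gc_newPot G hG hc hξ.le) hXb hXp hξ hcB hα₀ hα₁ hδ₁ hs hα₀' hγ₀' hα₁' h hw
    (closedSubgroupModel_gcValued G hG hE) (closedSubgroupModel_expI_mem_Gc G hG c.ξ (closedSubgroupModel_gcValued G hG hE))
    (closedSubgroupModel_gc_conjE G hG c.ξ (closedSubgroupModel_gcValued G hG hE)) hE0 hE1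

/-- **«A sufficiently small neighborhood of G-valued transformations», for every closed `G ≤ U(N)` with `Gᶜ` closed in `M_N(ℂ)`**:
for all `α₀′ > α₀`, `α₁′ > α₁`, `γ₀′ > γ₀` (and `ξα₁ < 1/16`) there is `δ > 0` such that every `v = w·exp(iξE)` with `w` `G`-valued,
`E` `𝐠ᶜ`-valued, `|E| ≤ δ`, `|∇^ξ_𝐔E| ≤ δ` carries the pairs satisfying (i)–(iii) with `(α₀, α₁, γ₀)` into those with
`(α₀′, α₁′, γ₀′)` (p07's `exists_neighbourhood_step`, model hypotheses discharged). [cite: Balaban1987RG1, (3.29) p.276] -/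
theorem exists_neighbourhood_closed (hc : IsClosed (Units.val '' (complexifiedGroup G : Set (Matrix n n ℂ)ˣ)))
    {F : Frame P i (Matrix n n ℂ)} (hXb : ∀ b, b ∈ F.X.bonds) (hXp : ∀ p, p ∈ F.X.plaqs) {c : StepConsts} (hξ : 0 < c.ξ)
    (hcB : 0 ≤ c.cB) {α₀ α₁ γ₀ α₀' α₁' γ₀' : ℝ} (hα₀ : 0 ≤ α₀) (hα₁ : 0 ≤ α₁) (hγ₀ : 0 ≤ γ₀) (hξα : c.ξ * α₁ < 1 / 16)
    (hα₀' : α₀ < α₀') (hα₁' : α₁ < α₁') (hγ₀' : γ₀ < γ₀') :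
    ∃ δ : ℝ, 0 < δ ∧ ∀ {Φ : FieldPair P i (Matrix n n ℂ)ˣ (Matrix n n ℂ)}, SatisfiesI_III (closedSubgroupModel G hG) F c α₀ α₁ γ₀ Φ →
      ∀ {w : Site P i → (Matrix n n ℂ)ˣ}, (∀ x, w x ∈ (closedSubgroupModel G hG).G) →
        ∀ {E : Site P i → Matrix n n ℂ}, (∀ x, E x ∈ lieC G hG) → (∀ x, ‖E x‖ ≤ δ) → (∀ x μ, ‖nabla c.ξ Φ.U μ E x‖ ≤ δ) →
          SatisfiesI_III (closedSubgroupModel G hG) F c α₀' α₁' γ₀' (act (w * fun x => expI c.ξ (E x)) Φ) := by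
  obtain ⟨δ, hδ, hmain⟩ := exists_neighbourhood_step (closedSubgroupModel_norm_le G hG) (closedSubgroupModel_G_le_Gc G hG)
    (closedSubgroupModel_gc_conj G hG) (closedSubgroupModel_gc_newPot G hG hc hξ.le) hXb hXp hξ hcB hα₀ hα₁ hγ₀ hξα hα₀' hα₁' hγ₀'
    (𝓜 := closedSubgroupModel G hG) (F := F)
  exact ⟨δ, hδ, fun h w hw E hE hE0 hE1 =>
    hmain h hw (closedSubgroupModel_gcValued G hG hE)
      (closedSubgroupModel_expI_mem_Gc G hG c.ξ (closedSubgroupModel_gcValued G hG hE))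
      (closedSubgroupModel_gc_conjE G hG c.ξ (closedSubgroupModel_gcValued G hG hE)) hE0 hE1⟩

/-- The near-`G` clause for every closed `G ≤ SU(N)` — print's connected semisimple compact groups (closedness of `Gᶜ` from §2).
[cite: Balaban1987RG1, §0 pp.251–252, (3.29) p.276] -/
theorem exists_neighbourhood_of_le [Nonempty n] (hSU : G ≤ specialUnitarySubgroup n)
    {F : Frame P i (Matrix n n ℂ)} (hXb : ∀ b, b ∈ F.X.bonds) (hXp : ∀ p, p ∈ F.X.plaqs) {c : StepConsts} (hξ : 0 < c.ξ)
    (hcB : 0 ≤ c.cB) {α₀ α₁ γ₀ α₀' α₁' γ₀' : ℝ} (hα₀ : 0 ≤ α₀) (hα₁ : 0 ≤ α₁) (hγ₀ : 0 ≤ γ₀) (hξα : c.ξ * α₁ < 1 / 16)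
    (hα₀' : α₀ < α₀') (hα₁' : α₁ < α₁') (hγ₀' : γ₀ < γ₀') :
    ∃ δ : ℝ, 0 < δ ∧ ∀ {Φ : FieldPair P i (Matrix n n ℂ)ˣ (Matrix n n ℂ)}, SatisfiesI_III (closedSubgroupModel G hG) F c α₀ α₁ γ₀ Φ →
      ∀ {w : Site P i → (Matrix n n ℂ)ˣ}, (∀ x, w x ∈ (closedSubgroupModel G hG).G) →
        ∀ {E : Site P i → Matrix n n ℂ}, (∀ x, E x ∈ lieC G hG) → (∀ x, ‖E x‖ ≤ δ) → (∀ x μ, ‖nabla c.ξ Φ.U μ E x‖ ≤ δ) →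
          SatisfiesI_III (closedSubgroupModel G hG) F c α₀' α₁' γ₀' (act (w * fun x => expI c.ξ (E x)) Φ) :=
  exists_neighbourhood_closed G hG (isClosed_val_image_complexifiedGroup_of_le G hSU) hXb hXp hξ hcB hα₀ hα₁ hγ₀ hξα hα₀' hα₁' hγ₀'

end Corollaries

/-! ## §5. Agreement with the two hand-made instances: `G = SU(N)` (p07's `suModel`) and `G = U(N)` (p07's `unitaryModel`) -/

section Agreement

open scoped Matrix.Norms.L2Operator
open Literature.MathematicalPhysics.QuantumFieldTheory.Balaban1983to89.B12LieComplexification (lieSubalgebra lieC complexify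
  complexify_unitaryLie_eq_top)
open Literature.MathematicalPhysics.QuantumFieldTheory.Balaban1983to89.B12ComplexifiedGroup (complexifiedGroup
  mem_complexifiedGroup_specialUnitarySubgroup_iff complexifiedGroup_top isClosed_top mem_lieSubalgebra_top_iff)
open Literature.MathematicalPhysics.QuantumFieldTheory.Balaban1983to89.B12SpecialUnitaryClosedSubgroup (specialUnitarySubgroup
  mem_specialUnitarySubgroup_iff isClosed_specialUnitarySubgroup lieC_specialUnitarySubgroup)
open Literature.MathematicalPhysics.QuantumFieldTheory.Balaban1983to89.B12RegularSpaces111 (Model)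
open Literature.MathematicalPhysics.QuantumFieldTheory.Balaban1983to89.B12RegularSpaces111SpecialUnitary (suUnits mem_suUnits_iff
  slAlg mem_slAlg_iff suModel)
open Literature.MathematicalPhysics.QuantumFieldTheory.Balaban1983to89.B12RegularSpaces111Unitary (unitaryUnits mem_unitaryUnits
  unitaryModel)
open Literature.MathematicalPhysics.QuantumFieldTheory.Balaban1983to89.B13Inv214OrbitSUN (slUnits mem_slUnits_iff)
open Literature.Algebra.Lie.CompactKillingForm (unitaryLie mem_unitaryLie_iff)
open Literature.Algebra.Lie.SpecialLinearKilling (mem_sl_iff)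

attribute [local instance 100] LieRing.ofAssociativeRing

/-- **`G = SU(N)`: the model constructor returns p07's hand-made `suModel`** — `G`: the image of `specialUnitarySubgroup` in
`GL(N, ℂ)` is `suUnits` (unitary with `det = 1`); `Gᶜ`: p24's `SU(N)ᶜ = SL(N, ℂ)` = `slUnits`; `𝐠ᶜ`: p24's `𝔰𝔲(N)ᶜ = 𝔰𝔩(N, ℂ)` =
`slAlg` (traceless). [cite: Balaban1987RG1, §0 pp.251–252] -/
theorem closedSubgroupModel_specialUnitary (N : ℕ) [NeZero N] :
    closedSubgroupModel (specialUnitarySubgroup (Fin N)) (isClosed_specialUnitarySubgroup (Fin N)) = suModel N := by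
  have h1 : (closedSubgroupModel (specialUnitarySubgroup (Fin N)) (isClosed_specialUnitarySubgroup (Fin N))).G = suUnits N := by
    ext g
    rw [mem_closedSubgroupModel_G_iff, mem_suUnits_iff, Matrix.mem_specialUnitaryGroup_iff]
    constructor
    · rintro ⟨h, hmem⟩
      exact ⟨h, (mem_specialUnitarySubgroup_iff.1 hmem : _)⟩
    · rintro ⟨h, hdet⟩
      exact ⟨h, mem_specialUnitarySubgroup_iff.2 hdet⟩
  have h2 : (closedSubgroupModel (specialUnitarySubgroup (Fin N)) (isClosed_specialUnitarySubgroup (Fin N))).Gc = slUnits N := by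
    ext g
    rw [closedSubgroupModel_Gc, mem_complexifiedGroup_specialUnitarySubgroup_iff, mem_slUnits_iff]
  have h3 : (closedSubgroupModel (specialUnitarySubgroup (Fin N)) (isClosed_specialUnitarySubgroup (Fin N))).gc = slAlg N := by
    ext X
    rw [mem_closedSubgroupModel_gc_iff, lieC_specialUnitarySubgroup, mem_sl_iff, mem_slAlg_iff]
  cases hM : closedSubgroupModel (specialUnitarySubgroup (Fin N)) (isClosed_specialUnitarySubgroup (Fin N)) with
  | mk G' Gc' gc' =>
    rw [hM] at h1 h2 h3
    simp only at h1 h2 h3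
    subst h1 h2 h3
    rfl

variable {n : Type*} [Fintype n] [DecidableEq n]

/-- `𝐠(U(N)) = 𝔲(N)`: the Lie algebra of the whole unitary group is the skew-Hermitian matrices (p24's `mem_lieSubalgebra_top_iff`).
[cite: Balaban1985Averaging, §A p.20] -/
theorem lieSubalgebra_top_eq_unitaryLie :
    lieSubalgebra (⊤ : Subgroup (Matrix.unitaryGroup n ℂ)) isClosed_top = unitaryLie n := by
  ext X
  rw [mem_lieSubalgebra_top_iff, mem_unitaryLie_iff, Matrix.star_eq_conjTranspose]

/-- `𝐠ᶜ(U(N)) = M_N(ℂ)` («the complexification of U(N) is the general linear complex group GL(ℂ, N)» at the Lie-algebra level;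
tree `complexify_unitaryLie_eq_top`). [cite: Balaban1985Averaging, §A p.20] -/
theorem lieC_top_eq_top : lieC (⊤ : Subgroup (Matrix.unitaryGroup n ℂ)) isClosed_top = ⊤ := by
  rw [lieC, lieSubalgebra_top_eq_unitaryLie, complexify_unitaryLie_eq_top]

/-- **`G = U(N)`: the model constructor returns p07's hand-made `unitaryModel M_N(ℂ)`** — `G`: all unitary units; `Gᶜ`: p24's
`U(N)ᶜ = GL(N, ℂ)` (`complexifiedGroup_top`); `𝐠ᶜ = M_N(ℂ)` (`lieC_top_eq_top`). [cite: Balaban1987RG1, §0 p.252; Balaban1985Averaging, §A p.20] -/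
theorem closedSubgroupModel_top :
    closedSubgroupModel (⊤ : Subgroup (Matrix.unitaryGroup n ℂ)) isClosed_top = unitaryModel (Matrix n n ℂ) := by
  have h1 : (closedSubgroupModel (⊤ : Subgroup (Matrix.unitaryGroup n ℂ)) isClosed_top).G = unitaryUnits (Matrix n n ℂ) := by
    ext g
    rw [mem_closedSubgroupModel_G_iff, mem_unitaryUnits]
    exact ⟨fun ⟨h, _⟩ => h, fun h => ⟨h, Subgroup.mem_top _⟩⟩
  have h2 : (closedSubgroupModel (⊤ : Subgroup (Matrix.unitaryGroup n ℂ)) isClosed_top).Gc = ⊤ := by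
    rw [closedSubgroupModel_Gc, complexifiedGroup_top]
  have h3 : (closedSubgroupModel (⊤ : Subgroup (Matrix.unitaryGroup n ℂ)) isClosed_top).gc = ⊤ := by
    ext X
    rw [mem_closedSubgroupModel_gc_iff, lieC_top_eq_top]
    exact ⟨fun _ => Submodule.mem_top, fun _ => (LieSubalgebra.mem_top X : _)⟩
  cases hM : closedSubgroupModel (⊤ : Subgroup (Matrix.unitaryGroup n ℂ)) isClosed_top with
  | mk G' Gc' gc' =>
    rw [hM] at h1 h2 h3
    simp only at h1 h2 h3
    subst h1 h2 h3
    rfl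

end Agreement

/-! ## §6. Print's standing hypothesis: a CONNECTED closed `G ≤ U(N)` with SEMISIMPLE `𝐠` lies in `SU(N)` — so §2–§4 apply to it -/

section Semisimple

open scoped Matrix.Norms.L2Operator
open Literature.MathematicalPhysics.QuantumFieldTheory.Balaban1983to89.B12LieComplexification (lieSubalgebra lieC
  mem_lieSubalgebra_iff_mem_logChart_lie)
open Literature.MathematicalPhysics.QuantumFieldTheory.Balaban1983to89.B12ComplexifiedGroup (complexifiedGroup)
open Literature.MathematicalPhysics.QuantumFieldTheory.Balaban1983to89.B12SpecialUnitaryClosedSubgroup (specialUnitarySubgroup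
  mem_specialUnitarySubgroup_iff)
open Literature.MathematicalPhysics.QuantumFieldTheory.Balaban1983to89.B12LieCentreClosedSubgroup (closure_expGen_eq)
open Literature.MathematicalPhysics.QuantumFieldTheory.Balaban1983to89.B12Ward414 (adConst adConst_apply
  span_range_adConst_eq_top_of_isSemisimple)
open Literature.MathematicalPhysics.QuantumFieldTheory.Balaban1983to89.B12RegularSpaces111

variable {n : Type*} [Fintype n] [DecidableEq n]

attribute [local instance 100] LieRing.ofAssociativeRing

variable (G : Subgroup (UN n)) (hG : IsClosed (G : Set (UN n)))

/-- **Semisimple `𝐠` is traceless**: `𝐠 = [𝐠, 𝐠]` (the `ad_λ` span everything — the tree's Cartan-criterion lemma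
`B12Ward414.span_range_adConst_eq_top_of_isSemisimple`) and `tr(XY − YX) = 0`. [cite: Balaban1987RG1, §0 pp.251–252 («We assume that G is semisimple»); Hall2015, Prop. 7.6] -/
theorem trace_eq_zero_of_isSemisimple [LieAlgebra.IsSemisimple ℝ (lieSubalgebra G hG)] {X : Matrix n n ℂ}
    (hX : X ∈ lieSubalgebra G hG) : X.trace = 0 := by
  -- the real-linear functional `B ↦ tr (B ())` on `Unit → 𝐠`
  let τ : (Unit → lieSubalgebra G hG) →ₗ[ℝ] ℂ :=
    { toFun := fun B => ((B () : lieSubalgebra G hG) : Matrix n n ℂ).trace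
      map_add' := fun B B' => by simp [Matrix.trace_add]
      map_smul' := fun r B => by simp [Matrix.trace_smul] }
  have hτ : ∀ B, τ B = ((B () : lieSubalgebra G hG) : Matrix n n ℂ).trace := fun _ => rfl
  -- it kills every `ad_λ B`
  have hker : Submodule.span ℝ (⋃ l : lieSubalgebra G hG, Set.range (adConst (K := ℝ) (ι := Unit) l)) ≤ LinearMap.ker τ := by
    refine Submodule.span_le.2 fun B hB => ?_
    rcases Set.mem_iUnion.1 hB with ⟨l, C, rfl⟩
    rw [SetLike.mem_coe, LinearMap.mem_ker, hτ, adConst_apply, LieSubalgebra.coe_bracket, Ring.lie_def, Matrix.trace_sub,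
      Matrix.trace_mul_comm, sub_self]
  rw [span_range_adConst_eq_top_of_isSemisimple, top_le_iff] at hker
  have hmem : (fun _ : Unit => (⟨X, hX⟩ : lieSubalgebra G hG)) ∈ LinearMap.ker τ := by rw [hker]; exact Submodule.mem_top
  rw [LinearMap.mem_ker, hτ] at hmem
  exact hmem

/-- **A connected closed `G ≤ U(N)` with semisimple Lie algebra lies in `SU(N)`**: `G` is generated by `exp 𝐠` (p24's
`closure_expGen_eq`, Rossmann §2.4) and `det e^X = e^{tr X} = 1` for traceless `X` (Liouville). This is print's standing case
«an arbitrary semisimple compact Lie group G ⊂ U(N)» (connected), for which §2's closedness of `Gᶜ` and §3–§4 apply.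
[cite: Balaban1987RG1, §0 pp.251–252, p.259; Rossmann2002, §2.4 Prop. 3] -/
theorem le_specialUnitarySubgroup_of_isSemisimple (hconn : IsConnected (G : Set (UN n)))
    [LieAlgebra.IsSemisimple ℝ (lieSubalgebra G hG)] : G ≤ specialUnitarySubgroup n := by
  rw [← closure_expGen_eq G hG hconn, Subgroup.closure_le]
  rintro u ⟨X, hX, hu⟩
  rw [SetLike.mem_coe, mem_specialUnitarySubgroup_iff, hu, Literature.Analysis.Matrix.det_exp_eq_exp_trace,
    trace_eq_zero_of_isSemisimple G hG ((mem_lieSubalgebra_iff_mem_logChart_lie G hG).2 hX), NormedSpace.exp_zero]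

/-- Hence **`Gᶜ` is closed in `M_N(ℂ)` (so log-charted, §2) for every connected closed `G ≤ U(N)` with semisimple `𝐠`.**
[cite: Balaban1987RG1, §0 pp.251–252] -/
theorem isClosed_val_image_complexifiedGroup_of_isSemisimple [Nonempty n] (hconn : IsConnected (G : Set (UN n)))
    [LieAlgebra.IsSemisimple ℝ (lieSubalgebra G hG)] : IsClosed (Units.val '' (complexifiedGroup G : Set (Matrix n n ℂ)ˣ)) :=
  isClosed_val_image_complexifiedGroup_of_le G (le_specialUnitarySubgroup_of_isSemisimple G hG hconn)

variable {P : Params} {i : ℕ}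

/-- **The near-`G` clause of (3.29) for print's groups** — every connected closed `G ≤ U(N)` with semisimple `𝐠` — with ALL model
hypotheses discharged. [cite: Balaban1987RG1, §0 pp.251–252, (3.29) p.276] -/
theorem exists_neighbourhood_of_isSemisimple [Nonempty n] (hconn : IsConnected (G : Set (UN n)))
    [LieAlgebra.IsSemisimple ℝ (lieSubalgebra G hG)]
    {F : Frame P i (Matrix n n ℂ)} (hXb : ∀ b, b ∈ F.X.bonds) (hXp : ∀ p, p ∈ F.X.plaqs) {c : StepConsts} (hξ : 0 < c.ξ)
    (hcB : 0 ≤ c.cB) {α₀ α₁ γ₀ α₀' α₁' γ₀' : ℝ} (hα₀ : 0 ≤ α₀) (hα₁ : 0 ≤ α₁) (hγ₀ : 0 ≤ γ₀) (hξα : c.ξ * α₁ < 1 / 16)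
    (hα₀' : α₀ < α₀') (hα₁' : α₁ < α₁') (hγ₀' : γ₀ < γ₀') :
    ∃ δ : ℝ, 0 < δ ∧ ∀ {Φ : FieldPair P i (Matrix n n ℂ)ˣ (Matrix n n ℂ)}, SatisfiesI_III (closedSubgroupModel G hG) F c α₀ α₁ γ₀ Φ →
      ∀ {w : Site P i → (Matrix n n ℂ)ˣ}, (∀ x, w x ∈ (closedSubgroupModel G hG).G) →
        ∀ {E : Site P i → Matrix n n ℂ}, (∀ x, E x ∈ lieC G hG) → (∀ x, ‖E x‖ ≤ δ) → (∀ x μ, ‖nabla c.ξ Φ.U μ E x‖ ≤ δ) →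
          SatisfiesI_III (closedSubgroupModel G hG) F c α₀' α₁' γ₀' (act (w * fun x => expI c.ξ (E x)) Φ) :=
  exists_neighbourhood_closed G hG (isClosed_val_image_complexifiedGroup_of_isSemisimple G hG hconn) hXb hXp hξ hcB hα₀ hα₁ hγ₀
    hξα hα₀' hα₁' hγ₀'

end Semisimple

/-! ## §7. Without connectedness: a closed `G ≤ U(N)` with semisimple `𝐠` has `detᵏ = 1` on `G`, so `Gᶜ` is closed in `M_N(ℂ)` -/

section SemisimpleGeneral

open scoped Matrix.Norms.L2Operator
open Literature.Algebra.Lie.MatrixAlgebraicHull (algHull polyFun eq_zero_of_mem_algHull)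
open Literature.MathematicalPhysics.QuantumFieldTheory.Balaban1983to89.B12LieComplexification (lieSubalgebra lieC
  mem_lieSubalgebra_iff_mem_logChart_lie)
open Literature.MathematicalPhysics.QuantumFieldTheory.Balaban1983to89.B12ComplexifiedGroup (complexifiedGroup
  complexifiedGroup_eq_algHull isClosed_complexifiedGroup det_mem_polyFun)
open Literature.MathematicalPhysics.QuantumFieldTheory.Balaban1983to89.B12SpecialUnitaryClosedSubgroup (specialUnitarySubgroup
  mem_specialUnitarySubgroup_iff)
open Literature.MathematicalPhysics.QuantumFieldTheory.Balaban1983to89.B12IdentityComponentClosedSubgroup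
  (isClosed_map_connectedComponentOfOne isConnected_map_connectedComponentOfOne lie_map_connectedComponentOfOne_eq
  isOpen_connectedComponentOfOne connectedComponentOfOne_normal)
open Literature.MathematicalPhysics.QuantumFieldTheory.Balaban1983to89.B12RegularSpaces111

variable {n : Type*} [Fintype n] [DecidableEq n]

attribute [local instance 100] LieRing.ofAssociativeRing

variable (G : Subgroup (UN n)) (hG : IsClosed (G : Set (UN n)))

/-- The identity component `G₀ ≤ U(N)` has the same `𝐠` as `G` (p24), as an equality of Lie subalgebras. [cite: Rossmann2002, §2.4 Prop. 3] -/
theorem lieSubalgebra_connectedComponent_eq :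
    lieSubalgebra ((Subgroup.connectedComponentOfOne G).map G.subtype) (isClosed_map_connectedComponentOfOne G hG) =
      lieSubalgebra G hG := by
  ext X
  rw [mem_lieSubalgebra_iff_mem_logChart_lie, mem_lieSubalgebra_iff_mem_logChart_lie, lie_map_connectedComponentOfOne_eq G hG]

/-- **A closed `G ≤ U(N)` with semisimple `𝐠` has `det uᵏ = 1` on `G` for some `k ≥ 1`** (`k` = the number of components: the
identity component `G₀` is an open normal subgroup of the compact `G`, hence of finite index, and `G₀ ≤ SU(N)` by §6).
[cite: Balaban1987RG1, §0 pp.251–252; Rossmann2002, §2.4 Prop. 3] -/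
theorem exists_det_pow_eq_one_of_isSemisimple [LieAlgebra.IsSemisimple ℝ (lieSubalgebra G hG)] :
    ∃ k : ℕ, 0 < k ∧ ∀ u ∈ G, (u : Matrix n n ℂ).det ^ k = 1 := by
  set G₀ : Subgroup (UN n) := (Subgroup.connectedComponentOfOne G).map G.subtype with hG₀
  have hG₀cl : IsClosed (G₀ : Set (UN n)) := isClosed_map_connectedComponentOfOne G hG
  haveI : LieAlgebra.IsSemisimple ℝ (lieSubalgebra G₀ hG₀cl) := by
    rw [lieSubalgebra_connectedComponent_eq G hG]; infer_instance
  have hSU : G₀ ≤ specialUnitarySubgroup n :=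
    le_specialUnitarySubgroup_of_isSemisimple G₀ hG₀cl (isConnected_map_connectedComponentOfOne G)
  -- finite index of the identity component in the compact group `G`
  haveI : CompactSpace G := isCompact_iff_compactSpace.1 hG.isCompact
  haveI : (Subgroup.connectedComponentOfOne G).Normal := connectedComponentOfOne_normal G
  haveI hfin : Finite (G ⧸ Subgroup.connectedComponentOfOne G) :=
    Subgroup.quotient_finite_of_isOpen _ (isOpen_connectedComponentOfOne G hG)
  refine ⟨Nat.card (G ⧸ Subgroup.connectedComponentOfOne G), Nat.card_pos, fun u hu => ?_⟩
  -- `u^k ∈ G₀`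
  have hpow : (⟨u, hu⟩ : G) ^ Nat.card (G ⧸ Subgroup.connectedComponentOfOne G) ∈ Subgroup.connectedComponentOfOne G := by
    rw [← QuotientGroup.eq_one_iff, QuotientGroup.mk_pow]
    exact pow_card_eq_one'
  have hmem : u ^ Nat.card (G ⧸ Subgroup.connectedComponentOfOne G) ∈ G₀ :=
    ⟨_, hpow, by simp⟩
  have hdet := mem_specialUnitarySubgroup_iff.1 (hSU hmem)
  rwa [SubmonoidClass.coe_pow, Matrix.det_pow] at hdet

/-- **`detᵏ = 1` on `G` propagates to `Gᶜ`** (it is a polynomial relation, `Gᶜ` = the algebraic hull).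
[cite: BrockerTomDieck1985, III (8.2) p.152; Balaban1987RG1, §0 p.252] -/
theorem det_pow_eq_one_of_mem_complexifiedGroup {k : ℕ} (hdet : ∀ u ∈ G, (u : Matrix n n ℂ).det ^ k = 1)
    {g : (Matrix n n ℂ)ˣ} (hg : g ∈ complexifiedGroup G) : (g : Matrix n n ℂ).det ^ k = 1 := by
  have hP : (fun g : (Matrix n n ℂ)ˣ => (g : Matrix n n ℂ).det ^ k - 1) ∈ polyFun n :=
    (polyFun n).sub_mem ((polyFun n).pow_mem det_mem_polyFun k) (polyFun n).one_mem
  rw [complexifiedGroup_eq_algHull] at hg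
  have h0 := eq_zero_of_mem_algHull hP (fun s hs => by
    obtain ⟨u, hu, rfl⟩ := Subgroup.mem_map.1 hs
    show ((Unitary.toUnits u : (Matrix n n ℂ)ˣ) : Matrix n n ℂ).det ^ k - 1 = 0
    rw [show ((Unitary.toUnits u : (Matrix n n ℂ)ˣ) : Matrix n n ℂ) = (u : Matrix n n ℂ) from rfl, hdet u hu, sub_self]) hg
  exact sub_eq_zero.1 h0

/-- **`Gᶜ` IS CLOSED IN `M_N(ℂ)` whenever `detᵏ = 1` on `G` for some `k ≥ 1`**: `Gᶜ` is closed in `GL(N, ℂ)` (p24), `GL → M_N` is an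
open embedding, and `Gᶜ ⊆ {detᵏ = 1}`, a closed subset of `M_N(ℂ)` inside `GL(N, ℂ)`. [cite: BrockerTomDieck1985, III (8.2) p.152] -/
theorem isClosed_val_image_complexifiedGroup_of_det_pow {k : ℕ} (hk : 0 < k)
    (hdet : ∀ u ∈ G, (u : Matrix n n ℂ).det ^ k = 1) : IsClosed (Units.val '' (complexifiedGroup G : Set (Matrix n n ℂ)ˣ)) := by
  obtain ⟨T, hT, hpre⟩ := (Units.isOpenEmbedding_val (R := Matrix n n ℂ)).isInducing.isClosed_iff.1
    (isClosed_complexifiedGroup G)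
  have hD : IsClosed {A : Matrix n n ℂ | A.det ^ k = 1} :=
    isClosed_singleton.preimage (continuous_id.matrix_det.pow k)
  suffices h : Units.val '' (complexifiedGroup G : Set (Matrix n n ℂ)ˣ) = T ∩ {A : Matrix n n ℂ | A.det ^ k = 1} by
    rw [h]; exact hT.inter hD
  ext A
  constructor
  · rintro ⟨g, hg, rfl⟩
    refine ⟨?_, det_pow_eq_one_of_mem_complexifiedGroup G hdet hg⟩
    have : g ∈ Units.val ⁻¹' T := by rw [hpre]; exact hg
    exact this
  · rintro ⟨hAT, hAdet⟩
    replace hAdet : A.det ^ k = 1 := hAdet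
    have hdet0 : IsUnit A.det := by
      refine isUnit_iff_ne_zero.2 fun h0 => ?_
      rw [h0, zero_pow hk.ne'] at hAdet
      exact zero_ne_one hAdet
    have hAu : IsUnit A := (Matrix.isUnit_iff_isUnit_det A).2 hdet0
    refine ⟨hAu.unit, ?_, hAu.unit_spec⟩
    have : hAu.unit ∈ Units.val ⁻¹' T := by
      show (hAu.unit : Matrix n n ℂ) ∈ T
      rw [hAu.unit_spec]; exact hAT
    rw [hpre] at this
    exact this

/-- **`Gᶜ` IS CLOSED IN `M_N(ℂ)` (hence log-charted, §2) FOR EVERY closed `G ≤ U(N)` WITH SEMISIMPLE `𝐠`** — print's standing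
hypothesis «G is semisimple … G ⊂ U(N)», connected or not. [cite: Balaban1987RG1, §0 pp.251–252] -/
theorem isClosed_val_image_complexifiedGroup_of_isSemisimple' [LieAlgebra.IsSemisimple ℝ (lieSubalgebra G hG)] :
    IsClosed (Units.val '' (complexifiedGroup G : Set (Matrix n n ℂ)ˣ)) := by
  obtain ⟨k, hk, hdet⟩ := exists_det_pow_eq_one_of_isSemisimple G hG
  exact isClosed_val_image_complexifiedGroup_of_det_pow G hk hdet

variable {P : Params} {i : ℕ}

/-- **The near-`G` clause of (3.29) for EVERY closed `G ≤ U(N)` with semisimple `𝐠`** (no connectedness), all model hypotheses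
discharged. [cite: Balaban1987RG1, §0 pp.251–252, (3.29) p.276] -/
theorem exists_neighbourhood_of_isSemisimple' [LieAlgebra.IsSemisimple ℝ (lieSubalgebra G hG)]
    {F : Frame P i (Matrix n n ℂ)} (hXb : ∀ b, b ∈ F.X.bonds) (hXp : ∀ p, p ∈ F.X.plaqs) {c : StepConsts} (hξ : 0 < c.ξ)
    (hcB : 0 ≤ c.cB) {α₀ α₁ γ₀ α₀' α₁' γ₀' : ℝ} (hα₀ : 0 ≤ α₀) (hα₁ : 0 ≤ α₁) (hγ₀ : 0 ≤ γ₀) (hξα : c.ξ * α₁ < 1 / 16)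
    (hα₀' : α₀ < α₀') (hα₁' : α₁ < α₁') (hγ₀' : γ₀ < γ₀') :
    ∃ δ : ℝ, 0 < δ ∧ ∀ {Φ : FieldPair P i (Matrix n n ℂ)ˣ (Matrix n n ℂ)}, SatisfiesI_III (closedSubgroupModel G hG) F c α₀ α₁ γ₀ Φ →
      ∀ {w : Site P i → (Matrix n n ℂ)ˣ}, (∀ x, w x ∈ (closedSubgroupModel G hG).G) →
        ∀ {E : Site P i → Matrix n n ℂ}, (∀ x, E x ∈ lieC G hG) → (∀ x, ‖E x‖ ≤ δ) → (∀ x μ, ‖nabla c.ξ Φ.U μ E x‖ ≤ δ) →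
          SatisfiesI_III (closedSubgroupModel G hG) F c α₀' α₁' γ₀' (act (w * fun x => expI c.ξ (E x)) Φ) :=
  exists_neighbourhood_closed G hG (isClosed_val_image_complexifiedGroup_of_isSemisimple' G hG) hXb hXp hξ hcB hα₀ hα₁ hγ₀
    hξα hα₀' hα₁' hγ₀'

end SemisimpleGeneral

end Literature.MathematicalPhysics.QuantumFieldTheory.Balaban1983to89.B12RegularSpaces111ClosedSubgroup

end
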